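import Mathlib
import HarnessLib
import Summits.Ventures.LatticeQCDFlow.Scaling.AutoregressiveGaugeHeatBathRanked

/-!
# LatticeQCDFlow / Scaling — peeling TWO plaquettes at a shared link: `∫ w(U_p) w(U_{p'}) Φ ≤ c·M₂ ∫ Φ`

HONEST FRAMING: exact (Metropolis-corrected) sampling algorithms for lattice gauge theory;
figures of merit are autocorrelation/cost numbers at stated couplings and volumes; no
continuum-physics claim.

Venture `LatticeQCDFlow` (cell pub-lqcd), topic `Scaling`, FANOUT row 30 (lean-1, GEN-26) — OUR WORK on
THEORY-2.md §4 row C5, the analytic step under the LOWER half of the volume law of the exact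
one-plaquette heat-bath sampler.  GEN-23's peeling (`Scaling/PlaquettePeelingRank`,
`integral_comp_plaquetteHolonomy_mul_of_mem`) redraws ONE link of ONE plaquette: `∫ w(U_p) Φ = c ∫ Φ` for
`Φ` blind to that link (`c = ∫ w dHaar`).  When an UNCOVERED plaquette `p'` is closed by the top link of a
covered plaquette `p`, the two weights share the redrawn link `e`, and in normal form
`U[e ↦ v]_p = A₁ v^{±1} B₁`, `U[e ↦ v]_{p'} = A₂ v^{±1} B₂`; after the Haar substitution `h = A₁ v^{±1} B₁`
the pair integrates to `∫ w(h) w(P h^{±1} Q) dHaar(h)`, which is at most the TWO-PLAQUETTE CONSTANT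
`K = c·M₂ := sup_{a,b} ∫ w(h) w(a h^{±1} b) dHaar(h)` (`M₂ ≤ M = sup w`, and `M₂ < M` unless `w` is
constant: the companion `Scaling/PlaquettePeelingClosingBound` and its sequels).

* §1 **`exists_plaquetteHolonomy_update_eq`** — one link of a plaquette in normal form `A·v^{±1}·B`;
* §2 `integral_two_weights_le_pp/pn/np/nn`, **`integral_update_two_plaquettes_le`** — two plaquettes
  sharing the redrawn link integrate to `≤ K` in each of the `4 × 4` positions, given
  `∫ w(h) w(a h b) ≤ K` and `∫ w(h) w(a h⁻¹ b) ≤ K` for all `a, b`;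
* §3 **`integral_weight_mul_weight_mul_le`** — the Fubini step over `Haar^{⊗E}`:
  `∫ w(U_p) w(U_{p'}) Φ ≤ K · ∫ Φ` for every bounded measurable `Φ ≥ 0` blind to the shared link.

No `def`, no `sorry`, nothing cited as a fact.
-/

noncomputable section

namespace Summit.Ventures.LatticeQCDFlow.Theory2.Autoregressive

open MeasureTheory Function Finset
open Literature.MathematicalPhysics.QuantumFieldTheory Literature.MathematicalPhysics.QuantumLattice
open Summit.Ventures.LatticeQCDFlow.Exactness

variable {d L : ℕ} [NeZero L] {G : Type*} [Group G] [TopologicalSpace G] [IsTopologicalGroup G]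
  [CompactSpace G] [SecondCountableTopology G] [MeasurableSpace G] [BorelSpace G]
/-! ## §1 One link of a plaquette in normal form -/

omit [TopologicalSpace G] [IsTopologicalGroup G] [CompactSpace G] [SecondCountableTopology G]
  [MeasurableSpace G] [BorelSpace G] in
/-- **Normal form.**  For each of the four links `e` of `p = (x; i, j)` (`i ≠ j`, `L ≥ 2`) there are
`A, B ∈ G` — words in the three other links — with `U[e ↦ v]_p = A·v·B` for all `v` (first and second
position) or `U[e ↦ v]_p = A·v⁻¹·B` for all `v` (third and fourth position). [ours] -/
theorem exists_plaquetteHolonomy_update_eq (hL : 2 ≤ L) (U : GaugeConfig d L G) (x : Site d L)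
    {i j : Fin d} (hij : i ≠ j) {e : Edge d L}
    (he : e ∈ ({(x, i), (x.shift i, j), (x.shift j, i), (x, j)} : Finset (Edge d L))) :
    ∃ A B : G, (∀ v, plaquetteHolonomy (update U e v) x i j = A * v * B) ∨
      (∀ v, plaquetteHolonomy (update U e v) x i j = A * v⁻¹ * B) := by
  simp only [Finset.mem_insert, Finset.mem_singleton] at he
  rcases he with rfl | rfl | rfl | rfl
  · exact ⟨1, U (x.shift i, j) * (U (x.shift j, i))⁻¹ * (U (x, j))⁻¹, Or.inl fun v => by
      rw [plaquetteHolonomy_update_first hL U x hij, one_mul]⟩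
  · exact ⟨U (x, i), (U (x.shift j, i))⁻¹ * (U (x, j))⁻¹, Or.inl fun v => by
      rw [plaquetteHolonomy_update_second hL U x hij]⟩
  · exact ⟨U (x, i) * U (x.shift i, j), (U (x, j))⁻¹, Or.inr fun v => by
      rw [plaquetteHolonomy_update_third hL U x hij]⟩
  · exact ⟨U (x, i) * U (x.shift i, j) * (U (x.shift j, i))⁻¹, 1, Or.inr fun v => by
      rw [plaquetteHolonomy_update_fourth hL U x hij, mul_one]⟩

/-! ## §2 Two plaquette weights sharing the redrawn link integrate to at most `c·M₂` -/

section TwoWeights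

omit [NeZero L]

variable {w : G → ℝ} {K : ℝ}

omit [SecondCountableTopology G] in
/-- Positions `(+, +)`: `∫ w(A₁ v B₁) w(A₂ v B₂) dHaar(v) ≤ K` (left translate by `A₁⁻¹`, right by `B₁⁻¹`).
[ours] -/
theorem integral_two_weights_le_pp (hK : ∀ a b : G, ∫ h, w h * w (a * h * b) ∂(haarProbability G) ≤ K)
    (A₁ B₁ A₂ B₂ : G) :
    ∫ v, w (A₁ * v * B₁) * w (A₂ * v * B₂) ∂(haarProbability G) ≤ K := by
  set f : G → ℝ := fun v => w v * w (A₂ * A₁⁻¹ * v * (B₁⁻¹ * B₂)) with hf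
  have h1 := integral_mul_left_eq_self (μ := haarProbability G) (fun v => f (v * B₁)) A₁
  have h2 := integral_mul_right_eq_self (μ := haarProbability G) f B₁
  have h3 : ∀ v, w (A₁ * v * B₁) * w (A₂ * v * B₂) = f (A₁ * v * B₁) := fun v => by
    simp only [hf]
    rw [show A₂ * A₁⁻¹ * (A₁ * v * B₁) * (B₁⁻¹ * B₂) = A₂ * v * B₂ by group]
  calc ∫ v, w (A₁ * v * B₁) * w (A₂ * v * B₂) ∂(haarProbability G)
      = ∫ v, f (A₁ * v * B₁) ∂(haarProbability G) := by simp_rw [h3]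
    _ = ∫ v, f (v * B₁) ∂(haarProbability G) := by simpa only using h1
    _ = ∫ v, f v ∂(haarProbability G) := h2
    _ ≤ K := hK _ _

omit [SecondCountableTopology G] in
/-- Positions `(+, −)`: `∫ w(A₁ v B₁) w(A₂ v⁻¹ B₂) dHaar(v) ≤ K`. [ours] -/
theorem integral_two_weights_le_pn (hK' : ∀ a b : G, ∫ h, w h * w (a * h⁻¹ * b) ∂(haarProbability G) ≤ K)
    (A₁ B₁ A₂ B₂ : G) :
    ∫ v, w (A₁ * v * B₁) * w (A₂ * v⁻¹ * B₂) ∂(haarProbability G) ≤ K := by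
  set f : G → ℝ := fun v => w v * w (A₂ * B₁ * v⁻¹ * (A₁ * B₂)) with hf
  have h1 := integral_mul_left_eq_self (μ := haarProbability G) (fun v => f (v * B₁)) A₁
  have h2 := integral_mul_right_eq_self (μ := haarProbability G) f B₁
  have h3 : ∀ v, w (A₁ * v * B₁) * w (A₂ * v⁻¹ * B₂) = f (A₁ * v * B₁) := fun v => by
    simp only [hf]
    rw [show A₂ * B₁ * (A₁ * v * B₁)⁻¹ * (A₁ * B₂) = A₂ * v⁻¹ * B₂ by group]
  calc ∫ v, w (A₁ * v * B₁) * w (A₂ * v⁻¹ * B₂) ∂(haarProbability G)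
      = ∫ v, f (A₁ * v * B₁) ∂(haarProbability G) := by simp_rw [h3]
    _ = ∫ v, f (v * B₁) ∂(haarProbability G) := by simpa only using h1
    _ = ∫ v, f v ∂(haarProbability G) := h2
    _ ≤ K := hK' _ _

omit [SecondCountableTopology G] in
/-- Positions `(−, +)`: `∫ w(A₁ v⁻¹ B₁) w(A₂ v B₂) dHaar(v) ≤ K` (inversion invariance, then `(+, −)`).
[ours] -/
theorem integral_two_weights_le_np (hK' : ∀ a b : G, ∫ h, w h * w (a * h⁻¹ * b) ∂(haarProbability G) ≤ K)
    (A₁ B₁ A₂ B₂ : G) :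
    ∫ v, w (A₁ * v⁻¹ * B₁) * w (A₂ * v * B₂) ∂(haarProbability G) ≤ K := by
  set F : G → ℝ := fun v => w (A₁ * v * B₁) * w (A₂ * v⁻¹ * B₂) with hF
  have h : ∀ v, w (A₁ * v⁻¹ * B₁) * w (A₂ * v * B₂) = F v⁻¹ := fun v => by
    simp only [hF, inv_inv]
  calc ∫ v, w (A₁ * v⁻¹ * B₁) * w (A₂ * v * B₂) ∂(haarProbability G)
      = ∫ v, F v⁻¹ ∂(haarProbability G) := by simp_rw [h]
    _ = ∫ v, F v ∂(haarProbability G) := integral_inv_eq_self F _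
    _ ≤ K := integral_two_weights_le_pn hK' A₁ B₁ A₂ B₂

omit [SecondCountableTopology G] in
/-- Positions `(−, −)`: `∫ w(A₁ v⁻¹ B₁) w(A₂ v⁻¹ B₂) dHaar(v) ≤ K` (inversion invariance, then `(+, +)`).
[ours] -/
theorem integral_two_weights_le_nn (hK : ∀ a b : G, ∫ h, w h * w (a * h * b) ∂(haarProbability G) ≤ K)
    (A₁ B₁ A₂ B₂ : G) :
    ∫ v, w (A₁ * v⁻¹ * B₁) * w (A₂ * v⁻¹ * B₂) ∂(haarProbability G) ≤ K := by
  set F : G → ℝ := fun v => w (A₁ * v * B₁) * w (A₂ * v * B₂) with hF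
  have h : ∀ v, w (A₁ * v⁻¹ * B₁) * w (A₂ * v⁻¹ * B₂) = F v⁻¹ := fun v => by
    simp only [hF]
  calc ∫ v, w (A₁ * v⁻¹ * B₁) * w (A₂ * v⁻¹ * B₂) ∂(haarProbability G)
      = ∫ v, F v⁻¹ ∂(haarProbability G) := by simp_rw [h]
    _ = ∫ v, F v ∂(haarProbability G) := integral_inv_eq_self F _
    _ ≤ K := integral_two_weights_le_pp hK A₁ B₁ A₂ B₂

end TwoWeights

omit [SecondCountableTopology G] in
/-- **Two plaquettes sharing the redrawn link integrate to at most `K`.**  `L ≥ 2`; `p = (x; i, j)` and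
`p' = (y; k, l)` both have `e` among their links; `∫ w(h) w(a h^{±1} b) dHaar ≤ K` for all `a, b`.  Then
for every configuration `U`, `∫ w(U[e ↦ v]_p) · w(U[e ↦ v]_{p'}) dHaar(v) ≤ K` — whichever of the
`4 × 4` positions `e` occupies. [ours] -/
theorem integral_update_two_plaquettes_le (hL : 2 ≤ L) (U : GaugeConfig d L G) (x : Site d L)
    {i j : Fin d} (hij : i ≠ j) (y : Site d L) {k l : Fin d} (hkl : k ≠ l) {e : Edge d L}
    (he : e ∈ ({(x, i), (x.shift i, j), (x.shift j, i), (x, j)} : Finset (Edge d L)))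
    (he' : e ∈ ({(y, k), (y.shift k, l), (y.shift l, k), (y, l)} : Finset (Edge d L)))
    {w : G → ℝ} {K : ℝ} (hK : ∀ a b : G, ∫ h, w h * w (a * h * b) ∂(haarProbability G) ≤ K)
    (hK' : ∀ a b : G, ∫ h, w h * w (a * h⁻¹ * b) ∂(haarProbability G) ≤ K) :
    ∫ v, w (plaquetteHolonomy (update U e v) x i j) * w (plaquetteHolonomy (update U e v) y k l)
      ∂(haarProbability G) ≤ K := by
  obtain ⟨A₁, B₁, h₁⟩ := exists_plaquetteHolonomy_update_eq hL U x hij he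
  obtain ⟨A₂, B₂, h₂⟩ := exists_plaquetteHolonomy_update_eq hL U y hkl he'
  rcases h₁ with h₁ | h₁ <;> rcases h₂ with h₂ | h₂ <;> simp_rw [h₁, h₂]
  · exact integral_two_weights_le_pp hK A₁ B₁ A₂ B₂
  · exact integral_two_weights_le_pn hK' A₁ B₁ A₂ B₂
  · exact integral_two_weights_le_np hK' A₁ B₁ A₂ B₂
  · exact integral_two_weights_le_nn hK A₁ B₁ A₂ B₂

/-! ## §3 The Fubini step -/

/-- **Peeling two plaquettes at a shared link.**  `L ≥ 2`; `p = (x; i, j)`, `p' = (y; k, l)` share the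
link `e`; `w > 0` measurable with `w ≤ M` and `∫ w(h) w(a h^{±1} b) dHaar ≤ K`; `Φ ≥ 0` bounded measurable
and blind to `e`.  Then `∫ w(U_p) w(U_{p'}) Φ dHaar^{⊗E} ≤ K · ∫ Φ dHaar^{⊗E}`. [ours] -/
theorem integral_weight_mul_weight_mul_le (hL : 2 ≤ L) (x : Site d L) {i j : Fin d} (hij : i ≠ j)
    (y : Site d L) {k l : Fin d} (hkl : k ≠ l) {e : Edge d L}
    (he : e ∈ ({(x, i), (x.shift i, j), (x.shift j, i), (x, j)} : Finset (Edge d L)))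
    (he' : e ∈ ({(y, k), (y.shift k, l), (y.shift l, k), (y, l)} : Finset (Edge d L)))
    {w : G → ℝ} (hwm : Measurable w) (hw0 : ∀ g, 0 < w g) {M : ℝ} (hM : ∀ g, w g ≤ M) {K : ℝ}
    (hK : ∀ a b : G, ∫ h, w h * w (a * h * b) ∂(haarProbability G) ≤ K)
    (hK' : ∀ a b : G, ∫ h, w h * w (a * h⁻¹ * b) ∂(haarProbability G) ≤ K)
    {Φ : GaugeConfig d L G → ℝ} (hΦm : Measurable Φ) {C' : ℝ} (hΦb : ∀ U, |Φ U| ≤ C')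
    (hΦ0 : ∀ U, 0 ≤ Φ U) (hΦe : ∀ U v, Φ (update U e v) = Φ U) :
    ∫ U, w (plaquetteHolonomy U x i j) * w (plaquetteHolonomy U y k l) * Φ U
        ∂Measure.pi (fun _ : Edge d L => haarProbability G) ≤
      K * ∫ U, Φ U ∂Measure.pi (fun _ : Edge d L => haarProbability G) := by
  set μ := haarProbability G with hμ
  have huniv : (fun _ : Edge d L => μ) e Set.univ ≠ 0 := by simp [hμ]
  have hMpos : 0 < M := (hw0 1).trans_le (hM 1)
  have hC' : 0 ≤ C' := (abs_nonneg _).trans (hΦb 1)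
  have hFm : Measurable fun U : GaugeConfig d L G =>
      w (plaquetteHolonomy U x i j) * w (plaquetteHolonomy U y k l) * Φ U :=
    ((hwm.comp (measurable_plaquetteHolonomy x i j)).mul
      (hwm.comp (measurable_plaquetteHolonomy y k l))).mul hΦm
  have hFi : Integrable (fun U : GaugeConfig d L G =>
      w (plaquetteHolonomy U x i j) * w (plaquetteHolonomy U y k l) * Φ U)
      (Measure.pi fun _ : Edge d L => μ) := by
    refine Integrable.mono' (integrable_const (M * M * C')) hFm.aestronglyMeasurable
      (ae_of_all _ fun U => ?_)
    rw [Real.norm_eq_abs, abs_mul, abs_mul, abs_of_pos (hw0 _), abs_of_pos (hw0 _)]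
    exact mul_le_mul (mul_le_mul (hM _) (hM _) (hw0 _).le hMpos.le) (hΦb _) (abs_nonneg _)
      (mul_nonneg hMpos.le hMpos.le)
  have hΦi : Integrable Φ (Measure.pi fun _ : Edge d L => μ) :=
    Integrable.mono' (integrable_const C') hΦm.aestronglyMeasurable
      (ae_of_all _ fun U => by rw [Real.norm_eq_abs]; exact hΦb U)
  rw [integral_pi_eq_integral_integral_update' (fun _ : Edge d L => μ) e huniv hFi]
  simp only [measure_univ, inv_one, ENNReal.toReal_one, one_smul]
  have hinner : ∀ U : GaugeConfig d L G,
      ∫ v, w (plaquetteHolonomy (update U e v) x i j) * w (plaquetteHolonomy (update U e v) y k l) *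
          Φ (update U e v) ∂μ ≤ K * Φ U := by
    intro U
    simp only [hΦe]
    rw [integral_mul_const]
    exact mul_le_mul_of_nonneg_right
      (integral_update_two_plaquettes_le hL U x hij y hkl he he' hK hK') (hΦ0 U)
  calc ∫ U, ∫ v, w (plaquetteHolonomy (update U e v) x i j) *
          w (plaquetteHolonomy (update U e v) y k l) * Φ (update U e v) ∂μ
          ∂Measure.pi (fun _ : Edge d L => μ)
      ≤ ∫ U, K * Φ U ∂Measure.pi (fun _ : Edge d L => μ) :=
        integral_mono_of_nonneg
          (ae_of_all _ fun U => integral_nonneg fun v =>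
            mul_nonneg (mul_nonneg (hw0 _).le (hw0 _).le) (hΦ0 _))
          (hΦi.const_mul K) (ae_of_all _ hinner)
    _ = K * ∫ U, Φ U ∂Measure.pi (fun _ : Edge d L => μ) := integral_const_mul _ _

end Summit.Ventures.LatticeQCDFlow.Theory2.Autoregressive

end
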